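import Literature.AlgebraicTopology.FundamentalGroup.SpunLoops
import HarnessLib

/-!
# The fundamental group of a spun space is that of its base

Topic `Literature/AlgebraicTopology/FundamentalGroup` (general topology; sequel of
`SpunLoops.lean`, used for the fact seat
`provefact-Literature.Topology.FourManifolds.exists_diffeomorph_comp_incl_eq`, brick REALISE:
the boundary `#ᵖ(S¹ × S²) = {q(x, y) + z² + w² = c}` of the `1`-handlebody model
`{q(x, y) + z² + w² ≤ c} ⊂ ℝ⁴` is the spun space `Spun √(c - q)` over the planar domain
`{q ≤ c}`, and Laudenbach–Poénaru's diffeomorphisms `H₁, H₂, H₃` are to be recognised by their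
action on `π₁`).  Everything here is **proved**.

Recall (`SpunLoops.lean`) that for a topological space `B` and a continuous `r : B → ℝ`,
`r ≥ 0`, the *spun space* `Spun r = {(b, v) ∈ B × ℂ | ‖v‖ = r b}` carries the projection
`pr₁ : Spun r → B` and the section `sec b = (b, r b)`, `pr₁ ∘ sec = id`, and that at a base
point `x₀` with vanishing fibre coordinate every loop `γ` is homotopic rel endpoints to
`sec ∘ pr₁ ∘ γ` (`Literature.AlgebraicTopology.FundamentalGroup.Spun.homotopic_secPath`, the
explicit unwinding homotopy).

**Theorem** (`Spun.fundamentalGroupProjEquiv`).  At every base point `x₀ ∈ Spun r` with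
vanishing fibre coordinate, `(pr₁)_# : π₁(Spun r, x₀) → π₁(B, pr₁ x₀)` is an isomorphism with
inverse `sec_#`: `pr₁_# ∘ sec_# = (pr₁ ∘ sec)_# = id` on the nose
(`mapOfEq_projCM_mapOfEq_secCM`), and `sec_# ∘ pr₁_# [γ] = [sec ∘ pr₁ ∘ γ] = [γ]` by the
unwinding theorem (`mapOfEq_secCM_mapOfEq_projCM`).  (For the models: `π₁(#ᵖ S¹ × S², x₀)` is
the fundamental group of the disc with `p` holes, based at a boundary point — the free group on
the `p` holes; Laudenbach–Poénaru (1972), §2, p. 339: "`i_# : π₁ ∂Y_p → π₁ Y_p` is bijective",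
`Y_p ≃ ⋁ᵖ S¹`.)

**Naturality** (`Spun.mapOfEq_projCM_mapOfEq_eq`, `Spun.fundamentalGroupProjEquiv_mapOfEq`).  If a
continuous map `F : Spun r → Spun r'` covers `f : B → B'` (`pr₁ ∘ F = f ∘ pr₁`), then
`pr₁_# ∘ F_# = f_# ∘ pr₁_#`; hence under the identifications `π₁(Spun) ≅ π₁(base)` at base
points with vanishing fibre coordinate, `F_#` *is* `f_#`
(`fundamentalGroupProjEquiv_mapOfEq_self` for based self-maps: `F_# = e⁻¹ ∘ f_# ∘ e`).  This is
how fibre-preserving symmetries of the `4`-dimensional models (lifts of symmetries of the planar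
Morse function `q`) are read off on `π₁` of the boundary from their planar shadows.

## References

* A. Hatcher, *Algebraic Topology* (2002), §1.1, p. 34 (induced homomorphisms, functoriality),
  Prop. 1.17 (retractions induce injections). [HatcherAT2002]
* F. Laudenbach, V. Poénaru, *A note on 4-dimensional handlebodies*, Bull. Soc. Math. France
  100 (1972), §2, p. 339. [LaudenbachPoenaruBSMF1972]
-/

open Set Function Complex
open scoped unitInterval

noncomputable section

namespace Literature.AlgebraicTopology.FundamentalGroup

/-! ### Induced maps on loops: computation rules on representatives -/

section MapOfEq

variable {X Y Z : Type*} [TopologicalSpace X] [TopologicalSpace Y] [TopologicalSpace Z]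

/-- Induction on `π₁(X, x)` by representatives, phrased with Mathlib's
`FundamentalGroup.fromPath` so that goals stay syntactically well typed. [folklore] -/
theorem ind_fromPath {x : X} {motive : _root_.FundamentalGroup X x → Prop}
    (h : ∀ γ : Path x x, motive (_root_.FundamentalGroup.fromPath (Path.Homotopic.Quotient.mk γ)))
    (a : _root_.FundamentalGroup X x) : motive a :=
  Quotient.ind h a

/-- The based homomorphism `f_#` on the class of a loop `γ` is the class of `f ∘ γ` (with its
endpoints rewritten along `f x = y`); Mathlib's `FundamentalGroup.mapOfEq_apply`, unfolded on
representatives (Hatcher (2002), §1.1). [folklore] -/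
theorem mapOfEq_fromPath (f : C(X, Y)) {x : X} {y : Y} (h : f x = y) (γ : Path x x) :
    _root_.FundamentalGroup.mapOfEq f h
        (_root_.FundamentalGroup.fromPath (Path.Homotopic.Quotient.mk γ)) =
      _root_.FundamentalGroup.fromPath
        (Path.Homotopic.Quotient.mk ((γ.map f.continuous).cast h.symm h.symm)) := by
  rw [_root_.FundamentalGroup.mapOfEq_apply]
  rfl

/-- Two based homomorphisms in a row on the class of a loop: `g_# (f_# [γ]) = [g ∘ f ∘ γ]`.
[folklore] -/
theorem mapOfEq_mapOfEq_fromPath (f : C(X, Y)) (g : C(Y, Z)) {x : X} {y : Y} {z : Z}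
    (hf : f x = y) (hg : g y = z) (γ : Path x x) :
    _root_.FundamentalGroup.mapOfEq g hg (_root_.FundamentalGroup.mapOfEq f hf
        (_root_.FundamentalGroup.fromPath (Path.Homotopic.Quotient.mk γ))) =
      _root_.FundamentalGroup.fromPath (Path.Homotopic.Quotient.mk
        ((((γ.map f.continuous).cast hf.symm hf.symm).map g.continuous).cast hg.symm hg.symm)) := by
  rw [mapOfEq_fromPath f hf γ]
  exact mapOfEq_fromPath g hg _

end MapOfEq

namespace Spun

variable {B : Type*} [TopologicalSpace B] {r : B → ℝ}

/-! ### The projection and the section as continuous maps -/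

/-- The projection `pr₁ : Spun r → B` as a continuous map. [folklore] -/
abbrev projCM : C(Spun r, B) := ⟨proj, continuous_proj⟩

/-- `projCM` is `pr₁` as a function. [folklore] -/
theorem projCM_apply (p : Spun r) : projCM p = proj p := rfl

/-- The section `b ↦ (b, r b)` as a continuous map (for continuous `r ≥ 0`). [folklore] -/
abbrev secCM (hr : Continuous r) (hr0 : ∀ b, 0 ≤ r b) : C(B, Spun r) :=
  ⟨sec hr0, continuous_sec hr hr0⟩

/-- `secCM` is `sec` as a function. [folklore] -/
theorem secCM_apply (hr : Continuous r) (hr0 : ∀ b, 0 ≤ r b) (b : B) :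
    secCM hr hr0 b = sec hr0 b := rfl

/-! ### `pr₁_#` is an isomorphism at base points with vanishing fibre coordinate -/

section ProjSec

variable (hr : Continuous r) (hr0 : ∀ b, 0 ≤ r b)

/-- **`pr₁_# ∘ sec_# = id`** on `π₁(B, b₀)`, for any bookkeeping of base points
(`sec b₀ = x₀`, `pr₁ x₀ = b₀`): `pr₁ ∘ sec = id` on the nose, so `pr₁ ∘ sec ∘ δ = δ` as loops
(Hatcher (2002), §1.1: `(pr₁ ∘ sec)_# = pr₁_# ∘ sec_#`, and Prop. 1.17). [cite: HatcherAT2002, §1.1 and Prop. 1.17] -/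
theorem mapOfEq_projCM_mapOfEq_secCM {b₀ : B} {x₀ : Spun r} (hs : secCM hr hr0 b₀ = x₀)
    (hp : projCM x₀ = b₀) (a : _root_.FundamentalGroup B b₀) :
    _root_.FundamentalGroup.mapOfEq (projCM (r := r)) hp
        (_root_.FundamentalGroup.mapOfEq (secCM hr hr0) hs a) = a := by
  induction a using ind_fromPath with
  | h δ =>
    refine (mapOfEq_mapOfEq_fromPath _ _ _ _ δ).trans ?_
    exact congrArg (fun p => _root_.FundamentalGroup.fromPath (Path.Homotopic.Quotient.mk p))
      (Path.ext (funext fun _ => rfl))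

/-- **`sec_# ∘ pr₁_# = id`** on `π₁(Spun r, x₀)` at a base point `x₀` with vanishing fibre
coordinate: `sec_# (pr₁_# [γ]) = [sec ∘ pr₁ ∘ γ]`, and `sec ∘ pr₁ ∘ γ ≃ γ` rel endpoints by
the unwinding theorem `Spun.homotopic_secPath` of `SpunLoops.lean`. [folklore] -/
theorem mapOfEq_secCM_mapOfEq_projCM {x₀ : Spun r} (hx₀ : fib x₀ = 0)
    (a : _root_.FundamentalGroup (Spun r) x₀) :
    _root_.FundamentalGroup.mapOfEq (secCM hr hr0) (sec_proj_eq_of_fib_eq_zero hr0 hx₀)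
        (_root_.FundamentalGroup.mapOfEq (projCM (r := r)) rfl a) = a := by
  induction a using ind_fromPath with
  | h γ =>
    refine (mapOfEq_mapOfEq_fromPath _ _ _ _ γ).trans ?_
    refine congrArg _root_.FundamentalGroup.fromPath (Path.Homotopic.Quotient.eq.2 ?_)
    -- the loop `sec ∘ pr₁ ∘ γ` is `secPath γ`, homotopic to `γ` by the unwinding theorem
    have key : ∀ P : Path x₀ x₀, ⇑P = ⇑(secPath hr hr0 hx₀ γ) → P.Homotopic γ := by
      intro P hP
      obtain rfl : P = secPath hr hr0 hx₀ γ := Path.ext hP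
      exact (homotopic_secPath hr hr0 hx₀ γ).symm
    exact key _ (funext fun _ => rfl)

/-- **The fundamental group of a spun space is that of its base.**  At a base point `x₀` with
vanishing fibre coordinate (`r (pr₁ x₀) = 0`), the projection induces an isomorphism
`pr₁_# : π₁(Spun r, x₀) ≅ π₁(B, pr₁ x₀)`, with inverse `sec_#`
(`mapOfEq_projCM_mapOfEq_secCM`, `mapOfEq_secCM_mapOfEq_projCM`).  For the boundary
`#ᵖ(S¹ × S²) = Spun √(c - q)` of the model `{q + z² + w² ≤ c} ⊂ ℝ⁴` this is
`π₁(#ᵖ S¹ × S², x₀) ≅ π₁({q ≤ c}, pr₁ x₀)`, the fundamental group of the disc with `p` holes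
(Laudenbach–Poénaru (1972), §2, p. 339). [folklore] -/
def fundamentalGroupProjEquiv {x₀ : Spun r} (hx₀ : fib x₀ = 0) :
    _root_.FundamentalGroup (Spun r) x₀ ≃* _root_.FundamentalGroup B (proj x₀) where
  toFun := _root_.FundamentalGroup.mapOfEq (projCM (r := r)) rfl
  invFun := _root_.FundamentalGroup.mapOfEq (secCM hr hr0) (sec_proj_eq_of_fib_eq_zero hr0 hx₀)
  left_inv a := mapOfEq_secCM_mapOfEq_projCM hr hr0 hx₀ a
  right_inv a := mapOfEq_projCM_mapOfEq_secCM hr hr0 (sec_proj_eq_of_fib_eq_zero hr0 hx₀) rfl a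
  map_mul' := map_mul _

/-- `fundamentalGroupProjEquiv` is `pr₁_#`. [folklore] -/
@[simp] theorem fundamentalGroupProjEquiv_apply {x₀ : Spun r} (hx₀ : fib x₀ = 0)
    (a : _root_.FundamentalGroup (Spun r) x₀) :
    fundamentalGroupProjEquiv hr hr0 hx₀ a =
      _root_.FundamentalGroup.mapOfEq (projCM (r := r)) rfl a :=
  rfl

/-- The inverse of `fundamentalGroupProjEquiv` is `sec_#`. [folklore] -/
@[simp] theorem fundamentalGroupProjEquiv_symm_apply {x₀ : Spun r} (hx₀ : fib x₀ = 0)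
    (a : _root_.FundamentalGroup B (proj x₀)) :
    (fundamentalGroupProjEquiv hr hr0 hx₀).symm a =
      _root_.FundamentalGroup.mapOfEq (secCM hr hr0) (sec_proj_eq_of_fib_eq_zero hr0 hx₀) a :=
  rfl

include hr hr0 in
/-- **`pr₁_#` is injective** at a base point with vanishing fibre coordinate: a loop of the spun
space whose shadow in the base is null-homotopic is null-homotopic. [folklore] -/
theorem mapOfEq_projCM_injective {x₀ : Spun r} (hx₀ : fib x₀ = 0) :
    Injective (_root_.FundamentalGroup.mapOfEq (projCM (r := r)) (rfl : projCM x₀ = proj x₀)) :=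
  (fundamentalGroupProjEquiv hr hr0 hx₀).injective

include hr hr0 in
/-- **`pr₁_#` is surjective** at a base point with vanishing fibre coordinate: every loop of the
base lifts, up to homotopy, to the section. [folklore] -/
theorem mapOfEq_projCM_surjective {x₀ : Spun r} (hx₀ : fib x₀ = 0) :
    Surjective (_root_.FundamentalGroup.mapOfEq (projCM (r := r)) (rfl : projCM x₀ = proj x₀)) :=
  (fundamentalGroupProjEquiv hr hr0 hx₀).surjective

include hr hr0 in
/-- **Loops are determined by their shadows**: two elements of `π₁(Spun r, x₀)` (`x₀` with
vanishing fibre coordinate) with the same image under `pr₁_#` are equal. [folklore] -/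
theorem eq_of_mapOfEq_projCM_eq {x₀ : Spun r} (hx₀ : fib x₀ = 0)
    {a a' : _root_.FundamentalGroup (Spun r) x₀}
    (h : _root_.FundamentalGroup.mapOfEq (projCM (r := r)) (rfl : projCM x₀ = proj x₀) a =
      _root_.FundamentalGroup.mapOfEq (projCM (r := r)) rfl a') : a = a' :=
  mapOfEq_projCM_injective hr hr0 hx₀ h

end ProjSec

/-! ### Naturality: fibre-preserving maps act on `π₁` as their shadows do -/

section Naturality

variable {B' : Type*} [TopologicalSpace B'] {r' : B' → ℝ}

/-- **`pr₁_# ∘ F_# = f_# ∘ pr₁_#`** for a continuous map `F : Spun r → Spun r'` covering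
`f : B → B'` (`pr₁ ∘ F = f ∘ pr₁`), at any base points (functoriality of `π₁`, Hatcher (2002),
§1.1, p. 34: both sides are the class of the loop `pr₁ ∘ F ∘ γ = f ∘ pr₁ ∘ γ`). [cite: HatcherAT2002, §1.1] -/
theorem mapOfEq_projCM_mapOfEq_eq (F : C(Spun r, Spun r')) (f : C(B, B'))
    (hFf : ∀ p, proj (F p) = f (proj p)) {x₀ : Spun r} {x₀' : Spun r'} (hF : F x₀ = x₀')
    {b₀' : B'} (hp' : projCM x₀' = b₀') (hf : f (proj x₀) = b₀')
    (a : _root_.FundamentalGroup (Spun r) x₀) :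
    _root_.FundamentalGroup.mapOfEq (projCM (r := r')) hp' (_root_.FundamentalGroup.mapOfEq F hF a) =
      _root_.FundamentalGroup.mapOfEq f hf
        (_root_.FundamentalGroup.mapOfEq (projCM (r := r)) (rfl : projCM x₀ = proj x₀) a) := by
  induction a using ind_fromPath with
  | h γ =>
    refine (mapOfEq_mapOfEq_fromPath _ _ _ _ γ).trans ?_
    refine Eq.trans ?_ (mapOfEq_mapOfEq_fromPath _ _ _ _ γ).symm
    exact congrArg (fun p => _root_.FundamentalGroup.fromPath (Path.Homotopic.Quotient.mk p))
      (Path.ext (funext fun s => hFf (γ s)))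

/-- **Under `π₁(Spun) ≅ π₁(base)`, a fibre-preserving map is its shadow**: for `F` covering `f`
and base points `x₀`, `x₀' = F x₀` with vanishing fibre coordinates,
`e' (F_# a) = f_# (e a)` where `e = fundamentalGroupProjEquiv` at `x₀` and `e'` at `x₀'`.
[folklore] -/
theorem fundamentalGroupProjEquiv_mapOfEq (hr : Continuous r) (hr0 : ∀ b, 0 ≤ r b)
    (hr' : Continuous r') (hr0' : ∀ b, 0 ≤ r' b) (F : C(Spun r, Spun r')) (f : C(B, B'))
    (hFf : ∀ p, proj (F p) = f (proj p)) {x₀ : Spun r} {x₀' : Spun r'} (hx₀ : fib x₀ = 0)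
    (hx₀' : fib x₀' = 0) (hF : F x₀ = x₀') (a : _root_.FundamentalGroup (Spun r) x₀) :
    fundamentalGroupProjEquiv hr' hr0' hx₀' (_root_.FundamentalGroup.mapOfEq F hF a) =
      _root_.FundamentalGroup.mapOfEq f (show f (proj x₀) = proj x₀' by rw [← hFf, hF])
        (fundamentalGroupProjEquiv hr hr0 hx₀ a) :=
  mapOfEq_projCM_mapOfEq_eq F f hFf hF rfl _ a

/-- **A fibre-preserving based self-map acts on `π₁(Spun r, x₀)` as the conjugate of its
shadow**: if `F : Spun r → Spun r` covers `f : B → B` and fixes a base point `x₀` with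
vanishing fibre coordinate (so `f` fixes `b₀ = pr₁ x₀`), then `F_# = e⁻¹ ∘ f_# ∘ e` with
`e = fundamentalGroupProjEquiv : π₁(Spun r, x₀) ≅ π₁(B, b₀)` — the format
"`χ_# a = e⁻¹ (ν (e a))`" in which the realisation fact REALISE of
`Literature/Topology/FourManifolds/SPC4HandlesNielsenReduction.lean` asks for automorphisms of
`π₁` of the boundary of the models to be exhibited. [folklore] -/
theorem fundamentalGroupProjEquiv_mapOfEq_self (hr : Continuous r) (hr0 : ∀ b, 0 ≤ r b)
    (F : C(Spun r, Spun r)) (f : C(B, B)) (hFf : ∀ p, proj (F p) = f (proj p)) {x₀ : Spun r}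
    (hx₀ : fib x₀ = 0) (hF : F x₀ = x₀) (a : _root_.FundamentalGroup (Spun r) x₀) :
    _root_.FundamentalGroup.mapOfEq F hF a =
      (fundamentalGroupProjEquiv hr hr0 hx₀).symm
        (_root_.FundamentalGroup.mapOfEq f (show f (proj x₀) = proj x₀ by rw [← hFf, hF])
          (fundamentalGroupProjEquiv hr hr0 hx₀ a)) := by
  rw [MulEquiv.eq_symm_apply]
  exact fundamentalGroupProjEquiv_mapOfEq hr hr0 hr hr0 F f hFf hx₀ hx₀ hF a

/-- **Fibre-preserving maps with homotopically trivial shadow are `π₁`-trivial**: if `F` covers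
`f`, fixes a base point `x₀` with vanishing fibre coordinate, and `f_# = id` on `π₁(B, pr₁ x₀)`,
then `F_# = id` on `π₁(Spun r, x₀)`.  (With `f = id` this recovers the `π₁`-triviality of the
conjugation, `Spun.mapOfEq_conjCM_eq` of `SpunLoops.lean`, and applies verbatim to every
fibrewise rotation or reflection of the spun space.) [folklore] -/
theorem mapOfEq_eq_self_of_shadow (hr : Continuous r) (hr0 : ∀ b, 0 ≤ r b)
    (F : C(Spun r, Spun r)) (f : C(B, B)) (hFf : ∀ p, proj (F p) = f (proj p)) {x₀ : Spun r}
    (hx₀ : fib x₀ = 0) (hF : F x₀ = x₀)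
    (hf : ∀ c : _root_.FundamentalGroup B (proj x₀),
      _root_.FundamentalGroup.mapOfEq f (show f (proj x₀) = proj x₀ by rw [← hFf, hF]) c = c)
    (a : _root_.FundamentalGroup (Spun r) x₀) :
    _root_.FundamentalGroup.mapOfEq F hF a = a := by
  rw [fundamentalGroupProjEquiv_mapOfEq_self hr hr0 F f hFf hx₀ hF a, hf,
    MulEquiv.symm_apply_apply]

/-- **Fibrewise maps over the identity are `π₁`-trivial** at base points with vanishing fibre
coordinate: if `pr₁ ∘ F = pr₁` and `F x₀ = x₀`, then `F_# = id` on `π₁(Spun r, x₀)` (the case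
`f = id` of `mapOfEq_eq_self_of_shadow`; e.g. the conjugation `(b, v) ↦ (b, v̄)` and the
rotations `(b, v) ↦ (b, u(b) v)`, `|u| = 1`). [folklore] -/
theorem mapOfEq_eq_self_of_proj_comp_eq (hr : Continuous r) (hr0 : ∀ b, 0 ≤ r b)
    (F : C(Spun r, Spun r)) (hF₁ : ∀ p, proj (F p) = proj p) {x₀ : Spun r} (hx₀ : fib x₀ = 0)
    (hF : F x₀ = x₀) (a : _root_.FundamentalGroup (Spun r) x₀) :
    _root_.FundamentalGroup.mapOfEq F hF a = a := by
  refine mapOfEq_eq_self_of_shadow hr hr0 F (ContinuousMap.id B) hF₁ hx₀ hF (fun c => ?_) a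
  induction c using ind_fromPath with
  | h δ =>
    refine (mapOfEq_fromPath _ _ δ).trans ?_
    exact congrArg (fun p => _root_.FundamentalGroup.fromPath (Path.Homotopic.Quotient.mk p))
      (Path.ext (funext fun _ => rfl))

end Naturality

end Spun

end Literature.AlgebraicTopology.FundamentalGroup
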